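import Literature.AlgebraicGeometry.Motives.HodgeThetaSubalgebraUnitaryOrthogonalChain
import HarnessLib

/-!
# TOOL G without `i < j`: the slot constant of a non-zero commuting raising element is non-zero by definiteness,
# and the orthogonal-chain count for constant Levi profiles `(i, j)` with `i > 0`

Family `hodge`, layer `Literature/AlgebraicGeometry/Motives` (pure linear algebra over `ℂ`; no geometry). Research
context: cell `pub-hodge-ring2` (HONEST FRAMING: research route conditional on HC_CM; not a corollary; Q11.4-sentence-2
already refuted in dim ≥ 3), Literature lane gen 88. UNCONDITIONAL; theorems only, no definition, no named fact
(D-0026), no `sorry`.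

WHY. `UnitaryOrthogonalChain.false_of_constProfile` (TOOL G) assumes the constant profile `(i, j)` has `i < j`; the
inequality is used at exactly one place of the chain `slot_identity → scalar_on_range → member / pair / orth_symm →
false_of_constProfile`: in `UnitaryLeviSetup.scalar_on_range`, to show that the slot constant `μ = λ(Y, Y)` of a
non-zero `Y` (`Y Y† B + B Y† Y = μ B`) is non-zero, by a dimension count `(rk B − i) + j > rk B`. The last `p = 41`
cell `(20 | 21)` of Ribet's theorem needs the profile `(6, 6)` at minimal rank `12` (pieces `8, 12, 12, 9`), where the
count of TOOL G works (`n_t ≤ 12, 6, 2, 0`, `Σ = 8 < 9`) but `i = j`.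

* §1 `UnitaryDefinite.re_mul_re_pos`: an anisotropic Hermitian form on a complex subspace is definite (`s x x`,
  `s y y` have the same sign for non-zero `x, y`): otherwise the real quadratic `t ↦ s(x + t y, x + t y)` has a root.
* §2 `UnitaryLeviSetup.slot_mu_ne_zero`: `μ ≠ 0` as soon as `Y(U⁺) ≠ 0`. If `μ = 0`, `B` intertwines `−Y†Y` on
  `Q ∩ U⁺` with `Y Y†` on `B(W)`; for an eigenvector `u` of `Y†Y` on a `Y†Y`-stable subspace of `Q ∩ U⁺`
  (eigenvalue `τ`): `s(Yu, Yu) = τ̄ s(u, u)` and `s(Y†Bu, Y†Bu) = −τ s(Bu, Bu)`, so definiteness on `P` and on `Q`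
  (§1) forces `Y u = 0`; induction over the `s`-orthogonal complement of `u` gives `Y = 0` on `Q ∩ U⁺`.
* §3 `UnitaryLeviSetup.scalar_on_range'`: `scalar_on_range` with `μ ≠ 0` as hypothesis in place of `i < j` (verbatim
  otherwise).
* §4 `UnitaryProfilePos.member`, `.pair`, `.orth_symm`: the packages of `HodgeThetaSubalgebraUnitaryProfileFourSix`
  with `X(U⁺) ≠ 0` in place of `i < j` (verbatim otherwise).
* §5 `UnitaryOrthogonalChain.false_of_constProfile_pos`: TOOL G with `0 < i` in place of `i < j` (verbatim otherwise).
[cite: Ribet1983, Thm. 3] [cite: Gordon1997, Thm. 6.3 (3)] [cite: GoodmanWallachGTM255, §2.3.1, §4.1.1]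
[cite: HoffmanKunze1971LinearAlgebra, §8.5, §9.2, §6.2, §3.1 Thm. 2] [cite: Deligne1982HodgeCycles, I §3 Prop. 3.4, 3.6]

## References
* [Ribet1983] K. A. Ribet, *Hodge classes on certain types of abelian varieties*, Amer. J. Math. 105 (1983), Thm. 3.
* [Gordon1997] B. B. Gordon, *A survey of the Hodge conjecture for abelian varieties*, Thm. 6.3 (3), pp. 18–19.
* [GoodmanWallachGTM255] R. Goodman, N. R. Wallach, GTM 255 (2009), §2.3.1, §4.1.1.
* [HoffmanKunze1971LinearAlgebra] K. Hoffman, R. Kunze, *Linear Algebra* (1971), §3.1 Thm. 2, §6.2, §8.5, §9.2.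
* [Deligne1982HodgeCycles] P. Deligne, *Hodge cycles on abelian varieties*, LNM 900 (1982), I §3 Prop. 3.4, 3.6.
-/

noncomputable section

open Module

namespace Literature.AlgebraicGeometry.Motives

namespace HodgeStructure

universe u

variable {W : Type u} [AddCommGroup W] [Module ℂ W]

/-! ### §1 Definiteness from anisotropy -/

/-- **Anisotropic Hermitian forms are definite**: for non-zero `x, y` in a subspace `P` on which the Hermitian form `s`
has no isotropic vector, the real numbers `s x x` and `s y y` have the same sign (if `s x x > 0 > s y y`, the real
quadratic `t ↦ s (x + t y) (x + t y)` has a root). [cite: HoffmanKunze1971LinearAlgebra, §8.3, §9.2] -/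
theorem UnitaryDefinite.re_mul_re_pos {s : W → W → ℂ} (hadd : ∀ x y z, s (x + y) z = s x z + s y z)
    (hsmul : ∀ (c : ℂ) (x y : W), s (c • x) y = c * s x y) (hsymm : ∀ x y, s y x = starRingEnd ℂ (s x y))
    {P : Submodule ℂ W} (hdefP : ∀ p ∈ P, s p p = 0 → p = 0) {x y : W} (hx : x ∈ P) (hy : y ∈ P)
    (hx0 : x ≠ 0) (hy0 : y ≠ 0) : 0 < (s x x).re * (s y y).re := by
  obtain ⟨haddr, -, -, hnegr, hnegl, -, -⟩ := UnitaryTwoOdd.herm_right hadd hsymm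
  have hreal : ∀ a, starRingEnd ℂ (s a a) = s a a := fun a => by rw [← hsymm]
  have him : ∀ a, (s a a).im = 0 := fun a => by
    have h := congrArg Complex.im (hreal a)
    rw [Complex.conj_im] at h
    linarith
  have hne : ∀ a ∈ P, a ≠ 0 → (s a a).re ≠ 0 := fun a ha ha0 h =>
    ha0 (hdefP a ha (Complex.ext (by simpa using h) (by simpa using him a)))
  have hsmulr : ∀ (c : ℂ) (v w : W), s v (c • w) = starRingEnd ℂ c * s v w := fun c v w => by
    rw [hsymm (c • w) v, hsmul, map_mul, ← hsymm w v]
  -- no `x, y ∈ P` with `s x x > 0 > s y y`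
  have key : ∀ x y, x ∈ P → y ∈ P → 0 < (s x x).re → (s y y).re < 0 → False := by
    intro x y hx hy ha hb
    set a := (s x x).re with ha_def
    set b := (s y y).re with hb_def
    set β := (s x y).re + (s y x).re with hβ_def
    have hD : 0 ≤ β ^ 2 - 4 * b * a := by nlinarith
    set r := Real.sqrt (β ^ 2 - 4 * b * a) with hr_def
    have hr2 : r * r = β ^ 2 - 4 * b * a := Real.mul_self_sqrt hD
    have hb0 : b ≠ 0 := ne_of_lt hb
    set t : ℝ := (-β - r) / (2 * b) with ht_def
    have hquad : b * (t * t) + β * t + a = 0 := by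
      have h2b : (2 : ℝ) * b ≠ 0 := mul_ne_zero two_ne_zero hb0
      rw [ht_def]
      field_simp
      nlinarith [hr2]
    set v : W := x + (t : ℂ) • y with hv_def
    have hvP : v ∈ P := P.add_mem hx (P.smul_mem _ hy)
    have hsv : s v v = s x x + (t : ℂ) * (s x y + s y x) + (t : ℂ) * (t : ℂ) * s y y := by
      rw [hv_def, hadd, haddr, haddr, hsmulr, hsmul, hsmul, hsmulr, Complex.conj_ofReal]
      ring
    have hre : (s v v).re = a + t * β + t * t * b := by
      rw [hsv]
      simp only [Complex.add_re, Complex.mul_re, Complex.mul_im, Complex.ofReal_re, Complex.ofReal_im, him]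
      rw [← ha_def, hβ_def]
      ring
    have hsv0 : s v v = 0 := Complex.ext (by rw [hre, Complex.zero_re]; linarith) (by rw [him, Complex.zero_im])
    have hv0 : v = 0 := hdefP v hvP hsv0
    have hxy : x = -((t : ℂ) • y) := eq_neg_of_add_eq_zero_left (by rw [← hv_def, hv0])
    have hxx : s x x = (t : ℂ) * (t : ℂ) * s y y := by
      rw [hxy, hnegl, hnegr, neg_neg, hsmul, hsmulr, Complex.conj_ofReal]
      ring
    have ha' : a = t * t * b := by
      have h := congrArg Complex.re hxx
      simp only [Complex.mul_re, Complex.mul_im, Complex.ofReal_re, Complex.ofReal_im, him] at h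
      rw [← ha_def, ← hb_def] at h
      rw [h]; ring
    nlinarith [mul_self_nonneg t]
  rcases lt_trichotomy 0 (s x x).re with ha | ha | ha
  · rcases lt_trichotomy 0 (s y y).re with hb | hb | hb
    · exact mul_pos ha hb
    · exact absurd hb.symm (hne y hy hy0)
    · exact (key x y hx hy ha hb).elim
  · exact absurd ha.symm (hne x hx hx0)
  · rcases lt_trichotomy 0 (s y y).re with hb | hb | hb
    · exact (key y x hy hx hb ha).elim
    · exact absurd hb.symm (hne y hy hy0)
    · exact mul_pos_of_neg_of_neg ha hb

/-! ### §2 The slot constant is non-zero -/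

/-- **The slot constant of a non-zero element is non-zero, without `i < j`.** In the setting of
`UnitaryLeviSetup.scalar_on_range` (a raising `B` with involution `ι` and pieces, `Y` raising commuting with `ι` with
adjoint `Y†`, `Y Y† B + B Y† Y = μ B`): if `Y(U⁺) ≠ 0` then `μ ≠ 0`. (If `μ = 0`, `B` intertwines `−Y†Y` on `Q ∩ U⁺`
with `Y Y†` on `B(W)`; an eigenvector `u` of `Y†Y|_{Q ∩ U⁺}`, eigenvalue `τ`, gives `s(Yu, Yu) = τ̄ s(u, u)` and
`s(Y†Bu, Y†Bu) = −τ s(Bu, Bu)`, so definiteness of `s` on `P` and on `Q` forces `Y u = 0`; induction on an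
`s`-orthogonal complement gives `Y = 0` on `Q ∩ U⁺`.) [cite: GoodmanWallachGTM255, §4.1.1]
[cite: HoffmanKunze1971LinearAlgebra, §8.5, §9.2, §6.2] -/
theorem UnitaryLeviSetup.slot_mu_ne_zero [FiniteDimensional ℂ W] {Θ : Module.End ℂ W} (hΘΘ : Θ * Θ = 1)
    {P Q : Submodule ℂ W} (hP : ∀ x, x ∈ P ↔ Θ x = x) (hQ : ∀ x, x ∈ Q ↔ Θ x = -x)
    {s : W → W → ℂ} (hadd : ∀ x y z, s (x + y) z = s x z + s y z)
    (hsmul : ∀ (c : ℂ) (x y : W), s (c • x) y = c * s x y) (hsymm : ∀ x y, s y x = starRingEnd ℂ (s x y))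
    (hPQ : ∀ p ∈ P, ∀ q ∈ Q, s p q = 0) (hdefP : ∀ p ∈ P, s p p = 0 → p = 0) (hdefQ : ∀ q ∈ Q, s q q = 0 → q = 0)
    {B : Module.End ℂ W}
    {ι : Module.End ℂ W} {Up QU : Submodule ℂ W} (hιΘ : ι * Θ = Θ * ι)
    (hιs : ∀ x y, s (ι x) y = s x (ι y)) (hUp : ∀ x, x ∈ Up ↔ ι x = x)
    (hPM : ∀ x, x ∈ LinearMap.range B ↔ ι x = -x ∧ Θ x = x)
    (hQM : ∀ x, x ∈ Q ⊓ LinearMap.ker B ↔ ι x = -x ∧ Θ x = -x) (hQU : ∀ x, x ∈ QU ↔ ι x = x ∧ Θ x = -x)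
    {Y Ya : Module.End ℂ W} (hΘY : Θ * Y = Y) (hYΘ : Y * Θ = -Y) (hYc : Y * ι = ι * Y)
    (hYYa : ∀ x y, s (Y x) y = s x (Ya y))
    {μ : ℂ} (hYY : Y * Ya * B + B * Ya * Y = μ • B) (hi : Module.finrank ℂ (Up.map Y) ≠ 0) : μ ≠ 0 := by
  classical
  intro hμ0
  obtain ⟨haddr, h0r, h0l, hnegr, hnegl, hsubr, hsubl⟩ := UnitaryTwoOdd.herm_right hadd hsymm
  have hΘΘv : ∀ v, Θ (Θ v) = v := fun v => by rw [← Module.End.mul_apply, hΘΘ, Module.End.one_apply]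
  have hΘι : ∀ v, Θ (ι v) = ι (Θ v) := fun v => by rw [← Module.End.mul_apply, ← hιΘ, Module.End.mul_apply]
  obtain ⟨hΘYa, -, hYac, hYaY⟩ := UnitaryLeviSetup.adj_raise hΘΘ hP hQ hadd hsymm hPQ hdefP hdefQ hιs hΘY hYΘ hYc hYYa
  have hYι : ∀ v, Y (ι v) = ι (Y v) := fun v => by rw [← Module.End.mul_apply, hYc, Module.End.mul_apply]
  have hYaι : ∀ v, Ya (ι v) = ι (Ya v) := fun v => by rw [← Module.End.mul_apply, hYac, Module.End.mul_apply]
  have hΘYv : ∀ w, Θ (Y w) = Y w := fun w => by rw [← Module.End.mul_apply, hΘY]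
  have hΘYav : ∀ w, Θ (Ya w) = -(Ya w) := fun w => by rw [← Module.End.mul_apply, hΘYa, LinearMap.neg_apply]
  have hsmulr : ∀ (c : ℂ) (v w : W), s v (c • w) = starRingEnd ℂ c * s v w := fun c v w => by
    rw [hsymm (c • w) v, hsmul, map_mul, ← hsymm w v]
  have him : ∀ a, (s a a).im = 0 := fun a => by
    have h := congrArg Complex.im (show starRingEnd ℂ (s a a) = s a a by rw [← hsymm])
    rw [Complex.conj_im] at h
    linarith
  have hkillP : ∀ {Z : Module.End ℂ W}, Z * Θ = -Z → ∀ p, Θ p = p → Z p = 0 := by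
    intro Z hZ p hp
    have h : Z p = -(Z p) := by
      conv_lhs => rw [← hp, ← Module.End.mul_apply, hZ, LinearMap.neg_apply]
    have h2 : (2 : ℂ) • Z p = 0 := by rw [two_smul]; nth_rewrite 2 [h]; rw [add_neg_cancel]
    exact (smul_eq_zero.1 h2).resolve_left two_ne_zero
  have hBinj : ∀ a ∈ QU, B a = 0 → a = 0 := by
    intro a ha hBa
    obtain ⟨hιa, hΘa⟩ := (hQU a).1 ha
    have hmem : a ∈ Q ⊓ LinearMap.ker B := Submodule.mem_inf.2 ⟨(hQ a).2 hΘa, LinearMap.mem_ker.2 hBa⟩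
    obtain ⟨hιa', -⟩ := (hQM a).1 hmem
    rw [hιa] at hιa'
    have h2 : (2 : ℂ) • a = 0 := by rw [two_smul]; nth_rewrite 2 [hιa']; rw [add_neg_cancel]
    exact (smul_eq_zero.1 h2).resolve_left two_ne_zero
  -- `Y(U⁺) = Y(Q ∩ U⁺)`
  have hmapUp : Up.map Y = QU.map Y := by
    refine le_antisymm ?_ (Submodule.map_mono fun x hx => (hUp x).2 ((hQU x).1 hx).1)
    rintro _ ⟨v, hv, rfl⟩
    have hιv := (hUp v).1 hv
    have hv' : v = (2 : ℂ)⁻¹ • (v + Θ v) + (2 : ℂ)⁻¹ • (v - Θ v) := by module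
    have hvP : Θ ((2 : ℂ)⁻¹ • (v + Θ v)) = (2 : ℂ)⁻¹ • (v + Θ v) := by rw [map_smul, map_add, hΘΘv, add_comm]
    have hvQ : (2 : ℂ)⁻¹ • (v - Θ v) ∈ QU := (hQU _).2 ⟨by rw [map_smul, map_sub, ← hΘι, hιv], by
      rw [map_smul, map_sub, hΘΘv, ← smul_neg, neg_sub]⟩
    refine ⟨_, hvQ, ?_⟩
    conv_rhs => rw [hv', map_add, hkillP hYΘ _ hvP, zero_add]
  -- `Y† Y` preserves `Q ∩ U⁺`; the slot identity with `μ = 0`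
  have hT : ∀ u ∈ QU, Ya (Y u) ∈ QU := fun u hu =>
    (hQU _).2 ⟨by rw [← hYaι, ← hYι, ((hQU u).1 hu).1], hΘYav _⟩
  have hslot : ∀ u, Y (Ya (B u)) + B (Ya (Y u)) = 0 := fun u => by
    have h := congrArg (fun T : Module.End ℂ W => T u) hYY
    simp only [LinearMap.add_apply, Module.End.mul_apply, hμ0, zero_smul] at h
    exact h
  -- induction on an `s`-orthogonal flag: `Y` kills every `Y†Y`-stable subspace of `Q ∩ U⁺`
  have main : ∀ n : ℕ, ∀ V : Submodule ℂ W, V ≤ QU → Module.finrank ℂ V ≤ n →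
      (∀ v ∈ V, Ya (Y v) ∈ V) → ∀ v ∈ V, Y v = 0 := by
    intro n
    induction n with
    | zero =>
      intro V _ hfin _ v hv
      have hV : V = ⊥ := Submodule.finrank_eq_zero.1 (by omega)
      rw [hV, Submodule.mem_bot] at hv
      rw [hv, map_zero]
    | succ n ih =>
      intro V hVQ hfin hinv v hv
      by_cases hVbot : V = ⊥
      · rw [hVbot, Submodule.mem_bot] at hv
        rw [hv, map_zero]
      haveI : Nontrivial V := Submodule.nontrivial_iff_ne_bot.2 hVbot
      let T : Module.End ℂ V := (Ya * Y).restrict (p := V) (q := V) fun w hw => hinv w hw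
      obtain ⟨τ, hτ⟩ := Module.End.exists_eigenvalue T
      obtain ⟨⟨u, huV⟩, hu⟩ := hτ.exists_hasEigenvector
      have hu0 : u ≠ 0 := fun h => hu.2 (Subtype.ext h)
      have hTu : Ya (Y u) = τ • u := by
        have h := Module.End.mem_eigenspace_iff.1 hu.1
        have h' := congrArg Subtype.val h
        simpa [T, LinearMap.restrict_apply] using h'
      have huQU : u ∈ QU := hVQ huV
      have huQ : u ∈ Q := (hQ u).2 ((hQU u).1 huQU).2
      -- the eigenvector is killed by `Y`
      have hYu : Y u = 0 := by
        by_contra hYu0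
        have hYuP : Y u ∈ P := (hP _).2 (hΘYv u)
        have hBuP : B u ∈ P := (hP _).2 ((hPM _).1 (LinearMap.mem_range_self B u)).2
        have hYaBuQ : Ya (B u) ∈ Q := (hQ _).2 (hΘYav _)
        have hBu0 : B u ≠ 0 := fun h => hu0 (hBinj u huQU h)
        have hA : s (Y u) (Y u) = starRingEnd ℂ τ * s u u := by rw [hYYa, hTu, hsmulr]
        have h1 : Y (Ya (B u)) = -(τ • B u) := by
          have h := hslot u
          rw [hTu, map_smul] at h
          exact eq_neg_of_add_eq_zero_left h
        have hB' : s (Ya (B u)) (Ya (B u)) = -(τ * s (B u) (B u)) := by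
          rw [← hYYa, h1, hnegl, hsmul]
        have hτ0 : τ ≠ 0 := by
          intro h
          rw [h, map_zero, zero_mul] at hA
          exact hYu0 (hdefP _ hYuP hA)
        have hYaBu0 : Ya (B u) ≠ 0 := by
          intro h
          rw [h, h0l, eq_comm, neg_eq_zero, mul_eq_zero] at hB'
          rcases hB' with h' | h'
          · exact hτ0 h'
          · exact hBu0 (hdefP _ hBuP h')
        have hPpos := UnitaryDefinite.re_mul_re_pos hadd hsmul hsymm hdefP hBuP hYuP hBu0 hYu0
        have hQpos := UnitaryDefinite.re_mul_re_pos hadd hsmul hsymm hdefQ huQ hYaBuQ hu0 hYaBu0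
        have hAre : (s (Y u) (Y u)).re = τ.re * (s u u).re := by
          rw [hA, Complex.mul_re, Complex.conj_re, Complex.conj_im, him u]; ring
        have hBre : (s (Ya (B u)) (Ya (B u))).re = -(τ.re * (s (B u) (B u)).re) := by
          rw [hB', Complex.neg_re, Complex.mul_re, him (B u)]; ring
        rw [hAre] at hPpos
        rw [hBre] at hQpos
        nlinarith [hPpos, hQpos]
      -- the `s`-orthogonal complement of `u` in `V`
      let φ : W →ₗ[ℂ] ℂ :=
        { toFun := fun w => s w u, map_add' := fun w w' => hadd w w' u, map_smul' := fun c w => hsmul c w u }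
      have hφ : ∀ w, φ w = s w u := fun w => rfl
      set V' : Submodule ℂ W := V ⊓ LinearMap.ker φ with hV'def
      have hV'V : V' ≤ V := inf_le_left
      have huu : s u u ≠ 0 := fun h => hu0 (hdefQ u huQ h)
      have hV'lt : V' < V := by
        refine lt_of_le_of_ne hV'V fun h => huu ?_
        have hu' : u ∈ V' := h ▸ huV
        exact (hφ u) ▸ LinearMap.mem_ker.1 (Submodule.mem_inf.1 hu').2
      have hfin' : Module.finrank ℂ V' ≤ n := by
        have := Submodule.finrank_lt_finrank_of_lt hV'lt
        omega
      have hinv' : ∀ w ∈ V', Ya (Y w) ∈ V' := by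
        intro w hw
        obtain ⟨hwV, hwk⟩ := Submodule.mem_inf.1 hw
        refine Submodule.mem_inf.2 ⟨hinv w hwV, LinearMap.mem_ker.2 ?_⟩
        rw [hφ, hYaY, hYu, h0r]
      have hY' := ih V' (hV'V.trans hVQ) hfin' hinv'
      set c : ℂ := s v u / s u u with hcdef
      have hmem : v - c • u ∈ V' := by
        refine Submodule.mem_inf.2 ⟨V.sub_mem hv (V.smul_mem c huV), LinearMap.mem_ker.2 ?_⟩
        rw [hφ, hsubl, hsmul, hcdef, div_mul_cancel₀ _ huu, sub_self]
      calc Y v = Y (v - c • u) + c • Y u := by rw [map_sub, map_smul, sub_add_cancel]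
        _ = 0 := by rw [hY' _ hmem, hYu, smul_zero, add_zero]
  have hYQU : ∀ u ∈ QU, Y u = 0 := main _ QU le_rfl le_rfl hT
  apply hi
  rw [hmapUp]
  have h0 : QU.map Y = ⊥ := by
    refine (Submodule.eq_bot_iff _).2 ?_
    rintro _ ⟨u, hu, rfl⟩
    exact hYQU u hu
  rw [h0, finrank_bot]


/-! ### §3 Scalars on the range -/

/-- **Scalars on the range, with `μ ≠ 0` as a hypothesis instead of `i < j`** (verbatim
`UnitaryLeviSetup.scalar_on_range` minus its first step): `B(ker Y|_{Q∩U⁺}) = Y(U⁻)` and `Y X† = λ` on `Y(U⁻)` and on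
`Y(U⁺)`. [cite: GoodmanWallachGTM255, §4.1.1] [cite: Deligne1982HodgeCycles, I §3 Prop. 3.4, 3.6]
[cite: HoffmanKunze1971LinearAlgebra, §8.5, §3.1 Thm. 2] -/
theorem UnitaryLeviSetup.scalar_on_range' [FiniteDimensional ℂ W] {Θ : Module.End ℂ W} (hΘΘ : Θ * Θ = 1)
    {P Q : Submodule ℂ W} (hP : ∀ x, x ∈ P ↔ Θ x = x) (hQ : ∀ x, x ∈ Q ↔ Θ x = -x)
    {s : W → W → ℂ} (hadd : ∀ x y z, s (x + y) z = s x z + s y z) (hsymm : ∀ x y, s y x = starRingEnd ℂ (s x y))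
    (hPQ : ∀ p ∈ P, ∀ q ∈ Q, s p q = 0) (hdefP : ∀ p ∈ P, s p p = 0 → p = 0) (hdefQ : ∀ q ∈ Q, s q q = 0 → q = 0)
    {B : Module.End ℂ W}
    {ι : Module.End ℂ W} {Um Up QU : Submodule ℂ W} (hιι : ι * ι = 1) (hιΘ : ι * Θ = Θ * ι)
    (hιs : ∀ x y, s (ι x) y = s x (ι y)) (hUm : ∀ x, x ∈ Um ↔ ι x = -x) (hUp : ∀ x, x ∈ Up ↔ ι x = x)
    (hPM : ∀ x, x ∈ LinearMap.range B ↔ ι x = -x ∧ Θ x = x)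
    (hQM : ∀ x, x ∈ Q ⊓ LinearMap.ker B ↔ ι x = -x ∧ Θ x = -x) (hQU : ∀ x, x ∈ QU ↔ ι x = x ∧ Θ x = -x)
    (hfinQU : Module.finrank ℂ QU = Module.finrank ℂ (LinearMap.range B))
    {Y Ya X Xa : Module.End ℂ W} (hΘY : Θ * Y = Y) (hYΘ : Y * Θ = -Y) (hYc : Y * ι = ι * Y)
    (hYYa : ∀ x y, s (Y x) y = s x (Ya y))
    (hΘX : Θ * X = X) (hXΘ : X * Θ = -X) (hXc : X * ι = ι * X) (hXXa : ∀ x y, s (X x) y = s x (Xa y))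
    {μ c : ℂ} (hYY : Y * Ya * B + B * Ya * Y = μ • B) (hXY : Y * Xa * B + B * Xa * Y = c • B)
    (hsum : Module.finrank ℂ (Up.map Y) + Module.finrank ℂ (Um.map Y) = Module.finrank ℂ (LinearMap.range B))
    (hμ : μ ≠ 0) :
    μ ≠ 0 ∧ (∀ p ∈ Um.map Y, Y (Xa p) = c • p) ∧ (∀ v ∈ Up.map Y, Y (Xa v) = c • v) := by
  classical
  obtain ⟨-, h0r, -, -, -, -, -⟩ := UnitaryTwoOdd.herm_right hadd hsymm
  have hΘΘv : ∀ v, Θ (Θ v) = v := fun v => by rw [← Module.End.mul_apply, hΘΘ, Module.End.one_apply]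
  have hιιv : ∀ v, ι (ι v) = v := fun v => by rw [← Module.End.mul_apply, hιι, Module.End.one_apply]
  have hΘι : ∀ v, Θ (ι v) = ι (Θ v) := fun v => by rw [← Module.End.mul_apply, ← hιΘ, Module.End.mul_apply]
  obtain ⟨hΘYa, -, hYac, hYaY⟩ := UnitaryLeviSetup.adj_raise hΘΘ hP hQ hadd hsymm hPQ hdefP hdefQ hιs hΘY hYΘ hYc hYYa
  obtain ⟨hΘXa, -, hXac, -⟩ := UnitaryLeviSetup.adj_raise hΘΘ hP hQ hadd hsymm hPQ hdefP hdefQ hιs hΘX hXΘ hXc hXXa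
  have hYι : ∀ v, Y (ι v) = ι (Y v) := fun v => by rw [← Module.End.mul_apply, hYc, Module.End.mul_apply]
  have hYaι : ∀ v, Ya (ι v) = ι (Ya v) := fun v => by rw [← Module.End.mul_apply, hYac, Module.End.mul_apply]
  have hXaι : ∀ v, Xa (ι v) = ι (Xa v) := fun v => by rw [← Module.End.mul_apply, hXac, Module.End.mul_apply]
  have hΘYv : ∀ w, Θ (Y w) = Y w := fun w => by rw [← Module.End.mul_apply, hΘY]
  have hΘYav : ∀ w, Θ (Ya w) = -(Ya w) := fun w => by rw [← Module.End.mul_apply, hΘYa, LinearMap.neg_apply]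
  have hΘXav : ∀ w, Θ (Xa w) = -(Xa w) := fun w => by rw [← Module.End.mul_apply, hΘXa, LinearMap.neg_apply]
  have hkillP : ∀ {Z : Module.End ℂ W}, Z * Θ = -Z → ∀ p, Θ p = p → Z p = 0 := by
    intro Z hZ p hp
    have h : Z p = -(Z p) := by
      conv_lhs => rw [← hp, ← Module.End.mul_apply, hZ, LinearMap.neg_apply]
    have h2 : (2 : ℂ) • Z p = 0 := by rw [two_smul]; nth_rewrite 2 [h]; rw [add_neg_cancel]
    exact (smul_eq_zero.1 h2).resolve_left two_ne_zero
  have hBinj : ∀ a ∈ QU, B a = 0 → a = 0 := by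
    intro a ha hBa
    obtain ⟨hιa, hΘa⟩ := (hQU a).1 ha
    have hmem : a ∈ Q ⊓ LinearMap.ker B := Submodule.mem_inf.2 ⟨(hQ a).2 hΘa, LinearMap.mem_ker.2 hBa⟩
    obtain ⟨hιa', -⟩ := (hQM a).1 hmem
    rw [hιa] at hιa'
    have h2 : (2 : ℂ) • a = 0 := by rw [two_smul]; nth_rewrite 2 [hιa']; rw [add_neg_cancel]
    exact (smul_eq_zero.1 h2).resolve_left two_ne_zero
  -- `Y(U⁺) = Y(Q ∩ U⁺)` and `Y(U⁻) ⊆ B(W)`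
  have hmapUp : Up.map Y = QU.map Y := by
    refine le_antisymm ?_ (Submodule.map_mono fun x hx => (hUp x).2 ((hQU x).1 hx).1)
    rintro _ ⟨v, hv, rfl⟩
    have hιv := (hUp v).1 hv
    have hv' : v = (2 : ℂ)⁻¹ • (v + Θ v) + (2 : ℂ)⁻¹ • (v - Θ v) := by module
    have hvP : Θ ((2 : ℂ)⁻¹ • (v + Θ v)) = (2 : ℂ)⁻¹ • (v + Θ v) := by rw [map_smul, map_add, hΘΘv, add_comm]
    have hvQ : (2 : ℂ)⁻¹ • (v - Θ v) ∈ QU := (hQU _).2 ⟨by rw [map_smul, map_sub, ← hΘι, hιv], by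
      rw [map_smul, map_sub, hΘΘv, ← smul_neg, neg_sub]⟩
    refine ⟨_, hvQ, ?_⟩
    conv_rhs => rw [hv', map_add, hkillP hYΘ _ hvP, zero_add]
  have hVle : Um.map Y ≤ LinearMap.range B := by
    rintro _ ⟨u, hu, rfl⟩
    exact (hPM _).2 ⟨by rw [← hYι, (hUm u).1 hu, map_neg], hΘYv u⟩
  -- `N = ker Y|_{Q ∩ U⁺}` as a subspace of `W`, and its dimension
  set N : Submodule ℂ W := (LinearMap.ker (Y.domRestrict QU)).map QU.subtype with hN
  have hNmem : ∀ x, x ∈ N ↔ x ∈ QU ∧ Y x = 0 := by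
    intro x
    constructor
    · rintro ⟨v, hv, rfl⟩
      exact ⟨v.2, by simpa [LinearMap.mem_ker, LinearMap.domRestrict_apply] using hv⟩
    · rintro ⟨hx, hYx⟩
      exact ⟨⟨x, hx⟩, by simpa [LinearMap.mem_ker, LinearMap.domRestrict_apply] using hYx, rfl⟩
  have hfinN : Module.finrank ℂ N + Module.finrank ℂ (Up.map Y) = Module.finrank ℂ (LinearMap.range B) := by
    have h := LinearMap.finrank_range_add_finrank_ker (Y.domRestrict QU)
    rw [LinearMap.range_domRestrict] at h
    rw [hN, Submodule.finrank_map_subtype_eq, hmapUp, ← hfinQU]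
    omega
  have hfinNB : Module.finrank ℂ (N.map B) = Module.finrank ℂ N := by
    have h := LinearMap.finrank_range_add_finrank_ker (B.domRestrict N)
    rw [LinearMap.range_domRestrict] at h
    have hk0 : LinearMap.ker (B.domRestrict N) = ⊥ := by
      refine (Submodule.eq_bot_iff _).2 fun v hv => ?_
      rw [LinearMap.mem_ker, LinearMap.domRestrict_apply] at hv
      exact Subtype.ext (hBinj _ ((hNmem v).1 v.2).1 hv)
    rw [hk0, finrank_bot, add_zero] at h
    exact h
  have hNBle : N.map B ≤ LinearMap.range B := LinearMap.map_le_range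
  -- on `N`: `Y Y† (B v) = μ B v` and `Y X† (B v) = c B v`
  have hYYv : ∀ v ∈ N, Y (Ya (B v)) = μ • B v := by
    intro v hv
    have h := congrArg (fun T : Module.End ℂ W => T v) hYY
    simp only [LinearMap.add_apply, Module.End.mul_apply, LinearMap.smul_apply, ((hNmem v).1 hv).2, map_zero,
      add_zero] at h
    exact h
  have hXYv : ∀ v ∈ N, Y (Xa (B v)) = c • B v := by
    intro v hv
    have h := congrArg (fun T : Module.End ℂ W => T v) hXY
    simp only [LinearMap.add_apply, Module.End.mul_apply, LinearMap.smul_apply, ((hNmem v).1 hv).2, map_zero,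
      add_zero] at h
    exact h
  -- `B(N) = Y(U⁻)`
  have hNB : N.map B = Um.map Y := by
    refine Submodule.eq_of_le_of_finrank_eq ?_ (by omega)
    rintro _ ⟨v, hv, rfl⟩
    have hιBv : ι (B v) = -(B v) := ((hPM _).1 (LinearMap.mem_range_self B v)).1
    have hmemU : Ya (B v) ∈ Um := (hUm _).2 (by rw [← hYaι, hιBv, map_neg])
    have h : B v = μ⁻¹ • Y (Ya (B v)) := by rw [hYYv v hv, smul_smul, inv_mul_cancel₀ hμ, one_smul]
    rw [h]
    exact Submodule.smul_mem _ _ (Submodule.mem_map_of_mem hmemU)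
  refine ⟨hμ, fun p hp => ?_, fun w hw => ?_⟩
  · rw [← hNB] at hp
    obtain ⟨v, hv, rfl⟩ := Submodule.mem_map.1 hp
    exact hXYv v hv
  · rw [hmapUp] at hw
    obtain ⟨u, hu, rfl⟩ := Submodule.mem_map.1 hw
    -- `Y X† B u ∈ Y(U⁻) = B(N)`
    have hιBu : ι (B u) = -(B u) := ((hPM _).1 (LinearMap.mem_range_self B u)).1
    have hmem : Y (Xa (B u)) ∈ N.map B := by
      rw [hNB]
      exact Submodule.mem_map_of_mem ((hUm _).2 (by rw [← hXaι, hιBu, map_neg]))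
    obtain ⟨n, hn, hn'⟩ := Submodule.mem_map.1 hmem
    obtain ⟨hnQU, hYn⟩ := (hNmem n).1 hn
    have h := congrArg (fun T : Module.End ℂ W => T u) hXY
    simp only [LinearMap.add_apply, Module.End.mul_apply, LinearMap.smul_apply] at h
    -- `B (X† Y u - c u + n) = 0` with the argument in `Q ∩ U⁺`
    have hιu := ((hQU u).1 hu).1
    have hXaYu : Xa (Y u) ∈ QU := (hQU _).2 ⟨by rw [← hXaι, ← hYι, hιu], hΘXav _⟩
    have hw0 : Xa (Y u) - c • u + n = 0 := by
      refine hBinj _ (Submodule.add_mem _ (Submodule.sub_mem _ hXaYu (Submodule.smul_mem _ c hu)) hnQU) ?_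
      rw [map_add, map_sub, map_smul, hn', ← h]
      abel
    have hXaYu' : Xa (Y u) = c • u - n := by
      rw [← sub_eq_zero]
      have : Xa (Y u) - (c • u - n) = Xa (Y u) - c • u + n := by abel
      rw [this, hw0]
    rw [hXaYu', map_sub, map_smul, hYn, sub_zero]

/-! ### §4 The packages -/

/-- **Member package without `i < j`** (verbatim `UnitaryProfileFourSix.member`, the non-vanishing `λ_X ≠ 0` now from
`UnitaryLeviSetup.slot_mu_ne_zero`, so only `X(U⁺) ≠ 0` is required). [cite: GoodmanWallachGTM255, §2.3.1, §4.1.1]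
[cite: HoffmanKunze1971LinearAlgebra, §8.5, §3.1 Thm. 2] [cite: Deligne1982HodgeCycles, I §3 Prop. 3.4, 3.6] -/
theorem UnitaryProfilePos.member [FiniteDimensional ℂ W] {𝔊 : Submodule ℂ (Module.End ℂ W)}
    (hbr : ∀ Y ∈ 𝔊, ∀ Z ∈ 𝔊, Y * Z - Z * Y ∈ 𝔊) {Θ : Module.End ℂ W} (hΘΘ : Θ * Θ = 1)
    {P Q : Submodule ℂ W} (hP : ∀ x, x ∈ P ↔ Θ x = x) (hQ : ∀ x, x ∈ Q ↔ Θ x = -x)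
    {s : W → W → ℂ} (hadd : ∀ x y z, s (x + y) z = s x z + s y z)
    (hsmul : ∀ (c : ℂ) (x y : W), s (c • x) y = c * s x y) (hsymm : ∀ x y, s y x = starRingEnd ℂ (s x y))
    (hPQ : ∀ p ∈ P, ∀ q ∈ Q, s p q = 0) (hdefP : ∀ p ∈ P, s p p = 0 → p = 0) (hdefQ : ∀ q ∈ Q, s q q = 0 → q = 0)
    (hadj : ∀ X ∈ 𝔊, ∃ Y ∈ 𝔊, ∀ x y, s (X x) y = s x (Y y))
    {B : Module.End ℂ W} (hΘB : Θ * B = B) (hBΘ : B * Θ = -B) (hB0 : B ≠ 0)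
    (hmin : ∀ Z ∈ 𝔊, Θ * Z = Z → Z * Θ = -Z → Z ≠ 0 →
      Module.finrank ℂ (LinearMap.range B) ≤ Module.finrank ℂ (LinearMap.range Z))
    {C : Module.End ℂ W} (hC : C ∈ 𝔊) (hBC : ∀ x y, s (B x) y = s x (C y))
    {ι : Module.End ℂ W} {Um Up QU : Submodule ℂ W} (hιι : ι * ι = 1) (hιΘ : ι * Θ = Θ * ι)
    (hιs : ∀ x y, s (ι x) y = s x (ι y)) (hUm : ∀ x, x ∈ Um ↔ ι x = -x) (hUp : ∀ x, x ∈ Up ↔ ι x = x)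
    (hPM : ∀ x, x ∈ LinearMap.range B ↔ ι x = -x ∧ Θ x = x)
    (hQM : ∀ x, x ∈ Q ⊓ LinearMap.ker B ↔ ι x = -x ∧ Θ x = -x) (hQU : ∀ x, x ∈ QU ↔ ι x = x ∧ Θ x = -x)
    (hfinQU : Module.finrank ℂ QU = Module.finrank ℂ (LinearMap.range B))
    {X Xa : Module.End ℂ W} (hX : X ∈ 𝔊) (hΘX : Θ * X = X) (hXΘ : X * Θ = -X) (hXc : X * ι = ι * X) (hX0 : X ≠ 0)
    (hXa : Xa ∈ 𝔊) (hXXa : ∀ x y, s (X x) y = s x (Xa y))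
    (hsum : Module.finrank ℂ (Up.map X) + Module.finrank ℂ (Um.map X) = Module.finrank ℂ (LinearMap.range B))
    (hi : Module.finrank ℂ (Up.map X) ≠ 0) :
    ∃ μ : ℂ, μ ≠ 0 ∧ starRingEnd ℂ μ = μ ∧ X * Xa * B + B * Xa * X = μ • B ∧ X * Xa * X = μ • X ∧
      (∀ p ∈ Up.map X, X (Xa p) = μ • p) ∧ (∀ p ∈ Um.map X, X (Xa p) = μ • p) ∧
      (∀ p ∈ Um.map X, ∃ q ∈ QU, X q = 0 ∧ B q = p) := by
  classical
  obtain ⟨-, h0r, -, -, -, -, -⟩ := UnitaryTwoOdd.herm_right hadd hsymm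
  obtain ⟨μ, hμB⟩ := UnitaryLeviSetup.slot_identity hbr hΘΘ hP hQ hadd hsymm hPQ hdefP hdefQ hadj hΘB hBΘ hB0 hmin hC
    hBC hιι hιΘ hιs hPM hQM hQU hfinQU hX hΘX hXΘ hXc hXXa hΘX hXΘ hXc hXa hXXa
  have hμ0 := UnitaryLeviSetup.slot_mu_ne_zero hΘΘ hP hQ hadd hsmul hsymm hPQ hdefP hdefQ hιΘ hιs hUp hPM hQM hQU
    hΘX hXΘ hXc hXXa hμB hi
  obtain ⟨hμ, hm, hp⟩ := UnitaryLeviSetup.scalar_on_range' hΘΘ hP hQ hadd hsymm hPQ hdefP hdefQ hιι hιΘ hιs hUm hUp hPM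
    hQM hQU hfinQU hΘX hXΘ hXc hXXa hΘX hXΘ hXc hXXa hμB hμB hsum hμ0
  have hXXX : X * Xa * X = μ • X := UnitaryLeviSetup.op_scalar hιι hUm hUp hm hp
  have hreal : starRingEnd ℂ μ = μ := UnitaryLeviSetup.slotConstant_real hP hsmul hsymm hdefP hΘX hXXa hXXX hX0
  refine ⟨μ, hμ, hreal, hμB, hXXX, hp, hm, fun p hpm => ?_⟩
  -- `B : Q ∩ U⁺ → B(W)` is a bijection; `X(U⁻) ⊆ B(W)`
  obtain ⟨hΘXa, -, hXac, -⟩ := UnitaryLeviSetup.adj_raise hΘΘ hP hQ hadd hsymm hPQ hdefP hdefQ hιs hΘX hXΘ hXc hXXa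
  have hXι : ∀ v, X (ι v) = ι (X v) := fun v => by rw [← Module.End.mul_apply, hXc, Module.End.mul_apply]
  have hXaι : ∀ v, Xa (ι v) = ι (Xa v) := fun v => by rw [← Module.End.mul_apply, hXac, Module.End.mul_apply]
  have hΘXv : ∀ w, Θ (X w) = X w := fun w => by rw [← Module.End.mul_apply, hΘX]
  have hΘXav : ∀ w, Θ (Xa w) = -(Xa w) := fun w => by rw [← Module.End.mul_apply, hΘXa, LinearMap.neg_apply]
  have hBinj : ∀ a ∈ QU, B a = 0 → a = 0 := by
    intro a ha hBa
    obtain ⟨hιa, hΘa⟩ := (hQU a).1 ha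
    have hmem : a ∈ Q ⊓ LinearMap.ker B := Submodule.mem_inf.2 ⟨(hQ a).2 hΘa, LinearMap.mem_ker.2 hBa⟩
    obtain ⟨hιa', -⟩ := (hQM a).1 hmem
    rw [hιa] at hιa'
    have h2 : (2 : ℂ) • a = 0 := by rw [two_smul]; nth_rewrite 2 [hιa']; rw [add_neg_cancel]
    exact (smul_eq_zero.1 h2).resolve_left two_ne_zero
  have hQUB : QU.map B = LinearMap.range B := by
    refine Submodule.eq_of_le_of_finrank_eq LinearMap.map_le_range ?_
    have hker := LinearMap.finrank_range_add_finrank_ker (B.domRestrict QU)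
    rw [LinearMap.range_domRestrict] at hker
    have hk0 : LinearMap.ker (B.domRestrict QU) = ⊥ := by
      refine (Submodule.eq_bot_iff _).2 fun v hv => ?_
      rw [LinearMap.mem_ker, LinearMap.domRestrict_apply] at hv
      exact Subtype.ext (hBinj _ v.2 hv)
    rw [hk0, finrank_bot, add_zero] at hker
    rw [hker, hfinQU]
  obtain ⟨u, hu, rfl⟩ := Submodule.mem_map.1 hpm
  have hXuP : X u ∈ LinearMap.range B := (hPM _).2 ⟨by rw [← hXι, (hUm u).1 hu, map_neg], hΘXv u⟩
  rw [← hQUB] at hXuP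
  obtain ⟨q, hq, hqXu⟩ := Submodule.mem_map.1 hXuP
  refine ⟨q, hq, ?_, hqXu⟩
  -- the slot identity at `q`: `X X† (B q) + B (X† X q) = μ B q`, and `X X† (B q) = μ B q`
  have h := congrArg (fun T : Module.End ℂ W => T q) hμB
  simp only [LinearMap.add_apply, Module.End.mul_apply, LinearMap.smul_apply] at h
  rw [hqXu, hm _ hpm, add_eq_left] at h
  -- `X† X q ∈ Q ∩ U⁺`, so it vanishes, so `X q` is isotropic
  obtain ⟨hιq, -⟩ := (hQU q).1 hq
  have hmemQU : Xa (X q) ∈ QU := (hQU _).2 ⟨by rw [← hXaι, ← hXι, hιq], hΘXav _⟩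
  have h0 : Xa (X q) = 0 := hBinj _ hmemQU h
  refine hdefP _ ((hP _).2 (hΘXv q)) ?_
  rw [hXXa, h0, h0r]

/-- **Orthogonal-pair package without `i < j`** (verbatim `UnitaryProfileFourSix.pair` with `Y(U⁺) ≠ 0`,
`(X+Y)(U⁺) ≠ 0` replacing the profile inequalities). [cite: GoodmanWallachGTM255, §2.3.1, §4.1.1]
[cite: HoffmanKunze1971LinearAlgebra, §8.5] [cite: Deligne1982HodgeCycles, I §3 Prop. 3.4, 3.6] -/
theorem UnitaryProfilePos.pair [FiniteDimensional ℂ W] {𝔊 : Submodule ℂ (Module.End ℂ W)}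
    (hbr : ∀ Y ∈ 𝔊, ∀ Z ∈ 𝔊, Y * Z - Z * Y ∈ 𝔊) {Θ : Module.End ℂ W} (hΘΘ : Θ * Θ = 1)
    {P Q : Submodule ℂ W} (hP : ∀ x, x ∈ P ↔ Θ x = x) (hQ : ∀ x, x ∈ Q ↔ Θ x = -x)
    {s : W → W → ℂ} (hadd : ∀ x y z, s (x + y) z = s x z + s y z)
    (hsmul : ∀ (c : ℂ) (x y : W), s (c • x) y = c * s x y) (hsymm : ∀ x y, s y x = starRingEnd ℂ (s x y))
    (hPQ : ∀ p ∈ P, ∀ q ∈ Q, s p q = 0) (hdefP : ∀ p ∈ P, s p p = 0 → p = 0) (hdefQ : ∀ q ∈ Q, s q q = 0 → q = 0)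
    (hadj : ∀ X ∈ 𝔊, ∃ Y ∈ 𝔊, ∀ x y, s (X x) y = s x (Y y))
    {B : Module.End ℂ W} (hΘB : Θ * B = B) (hBΘ : B * Θ = -B) (hB0 : B ≠ 0)
    (hmin : ∀ Z ∈ 𝔊, Θ * Z = Z → Z * Θ = -Z → Z ≠ 0 →
      Module.finrank ℂ (LinearMap.range B) ≤ Module.finrank ℂ (LinearMap.range Z))
    {C : Module.End ℂ W} (hC : C ∈ 𝔊) (hBC : ∀ x y, s (B x) y = s x (C y))
    {ι : Module.End ℂ W} {Um Up QU : Submodule ℂ W} (hιι : ι * ι = 1) (hιΘ : ι * Θ = Θ * ι)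
    (hιs : ∀ x y, s (ι x) y = s x (ι y)) (hUm : ∀ x, x ∈ Um ↔ ι x = -x) (hUp : ∀ x, x ∈ Up ↔ ι x = x)
    (hPM : ∀ x, x ∈ LinearMap.range B ↔ ι x = -x ∧ Θ x = x)
    (hQM : ∀ x, x ∈ Q ⊓ LinearMap.ker B ↔ ι x = -x ∧ Θ x = -x) (hQU : ∀ x, x ∈ QU ↔ ι x = x ∧ Θ x = -x)
    (hfinQU : Module.finrank ℂ QU = Module.finrank ℂ (LinearMap.range B))
    {X Xa Y Ya : Module.End ℂ W} (hX : X ∈ 𝔊) (hΘX : Θ * X = X) (hXΘ : X * Θ = -X) (hXc : X * ι = ι * X)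
    (hXXa : ∀ x y, s (X x) y = s x (Xa y))
    (hY : Y ∈ 𝔊) (hΘY : Θ * Y = Y) (hYΘ : Y * Θ = -Y) (hYc : Y * ι = ι * Y) (hYa : Ya ∈ 𝔊)
    (hYYa : ∀ x y, s (Y x) y = s x (Ya y))
    (hsumY : Module.finrank ℂ (Up.map Y) + Module.finrank ℂ (Um.map Y) = Module.finrank ℂ (LinearMap.range B))
    (hiY : Module.finrank ℂ (Up.map Y) ≠ 0)
    (hsumXY : Module.finrank ℂ (Up.map (X + Y)) + Module.finrank ℂ (Um.map (X + Y)) =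
      Module.finrank ℂ (LinearMap.range B))
    (hiXY : Module.finrank ℂ (Up.map (X + Y)) ≠ 0)
    (hXa : Xa ∈ 𝔊) {μ : ℂ} (hμreal : starRingEnd ℂ μ = μ)
    (hμB : X * Xa * B + B * Xa * X = μ • B) (hXXX : X * Xa * X = μ • X)
    (horth : Y * Xa * B + B * Xa * Y = 0) :
    X * Xa * Y + Y * Xa * X = μ • Y ∧ Ya * X * Xa + Xa * X * Ya = μ • Ya := by
  classical
  obtain ⟨haddr, -, -, -, -, -, -⟩ := UnitaryTwoOdd.herm_right hadd hsymm
  -- `Y X† Y = 0`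
  obtain ⟨ν, hνB⟩ := UnitaryLeviSetup.slot_identity hbr hΘΘ hP hQ hadd hsymm hPQ hdefP hdefQ hadj hΘB hBΘ hB0 hmin hC
    hBC hιι hιΘ hιs hPM hQM hQU hfinQU hY hΘY hYΘ hYc hYYa hΘY hYΘ hYc hYa hYYa
  have horth' : Y * Xa * B + B * Xa * Y = (0 : ℂ) • B := by rw [horth, zero_smul]
  have hν0 := UnitaryLeviSetup.slot_mu_ne_zero hΘΘ hP hQ hadd hsmul hsymm hPQ hdefP hdefQ hιΘ hιs hUp hPM hQM hQU
    hΘY hYΘ hYc hYYa hνB hiY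
  obtain ⟨-, hm0, hp0⟩ := UnitaryLeviSetup.scalar_on_range' hΘΘ hP hQ hadd hsymm hPQ hdefP hdefQ hιι hιΘ hιs hUm hUp hPM
    hQM hQU hfinQU hΘY hYΘ hYc hYYa hΘX hXΘ hXc hXXa hνB horth' hsumY hν0
  have hYXY : Y * Xa * Y = 0 := by
    rw [UnitaryLeviSetup.op_scalar hιι hUm hUp hm0 hp0, zero_smul]
  -- `(X + Y) X† (X + Y) = μ (X + Y)`
  have hΘS : Θ * (X + Y) = X + Y := by rw [mul_add, hΘX, hΘY]
  have hSΘ : (X + Y) * Θ = -(X + Y) := by rw [add_mul, hXΘ, hYΘ, neg_add]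
  have hSc : (X + Y) * ι = ι * (X + Y) := by rw [add_mul, mul_add, hXc, hYc]
  have hSa : Xa + Ya ∈ 𝔊 := Submodule.add_mem _ hXa hYa
  have hSSa : ∀ x y, s ((X + Y) x) y = s x ((Xa + Ya) y) := fun x y => by
    rw [LinearMap.add_apply, LinearMap.add_apply, hadd, haddr, hXXa, hYYa]
  obtain ⟨ρ, hρB⟩ := UnitaryLeviSetup.slot_identity hbr hΘΘ hP hQ hadd hsymm hPQ hdefP hdefQ hadj hΘB hBΘ hB0 hmin hC
    hBC hιι hιΘ hιs hPM hQM hQU hfinQU (Submodule.add_mem _ hX hY) hΘS hSΘ hSc hSSa hΘS hSΘ hSc hSa hSSa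
  have hXS : (X + Y) * Xa * B + B * Xa * (X + Y) = μ • B := by
    have : (X + Y) * Xa * B + B * Xa * (X + Y) = (X * Xa * B + B * Xa * X) + (Y * Xa * B + B * Xa * Y) := by
      simp only [add_mul, mul_add]; abel
    rw [this, hμB, horth, add_zero]
  have hρ0 := UnitaryLeviSetup.slot_mu_ne_zero hΘΘ hP hQ hadd hsmul hsymm hPQ hdefP hdefQ hιΘ hιs hUp hPM hQM hQU
    hΘS hSΘ hSc hSSa hρB hiXY
  obtain ⟨-, hmS, hpS⟩ := UnitaryLeviSetup.scalar_on_range' hΘΘ hP hQ hadd hsymm hPQ hdefP hdefQ hιι hιΘ hιs hUm hUp hPM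
    hQM hQU hfinQU hΘS hSΘ hSc hSSa hΘX hXΘ hXc hXXa hρB hXS hsumXY hρ0
  have hSXS : (X + Y) * Xa * (X + Y) = μ • (X + Y) := UnitaryLeviSetup.op_scalar hιι hUm hUp hmS hpS
  have hII : X * Xa * Y + Y * Xa * X = μ • Y := UnitaryLeviSetup.weight_one_of hXXX hYXY hSXS
  exact ⟨hII, UnitaryProfileFourSix.adjoint_weight_one hΘΘ hP hQ hadd hsmul hsymm hPQ hdefP hdefQ hXXa hYYa hμreal hII⟩

/-- **Symmetry of orthogonality without `i < j`** (verbatim `UnitaryProfileFourSix.orth_symm` with `X(U⁺) ≠ 0`,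
`Y(U⁺) ≠ 0`). [cite: HoffmanKunze1971LinearAlgebra, §8.5] [cite: GoodmanWallachGTM255, §4.1.1] -/
theorem UnitaryProfilePos.orth_symm [FiniteDimensional ℂ W] {𝔊 : Submodule ℂ (Module.End ℂ W)}
    (hbr : ∀ Y ∈ 𝔊, ∀ Z ∈ 𝔊, Y * Z - Z * Y ∈ 𝔊) {Θ : Module.End ℂ W} (hΘΘ : Θ * Θ = 1)
    {P Q : Submodule ℂ W} (hP : ∀ x, x ∈ P ↔ Θ x = x) (hQ : ∀ x, x ∈ Q ↔ Θ x = -x)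
    {s : W → W → ℂ} (hadd : ∀ x y z, s (x + y) z = s x z + s y z)
    (hsmul : ∀ (c : ℂ) (x y : W), s (c • x) y = c * s x y) (hsymm : ∀ x y, s y x = starRingEnd ℂ (s x y))
    (hPQ : ∀ p ∈ P, ∀ q ∈ Q, s p q = 0) (hdefP : ∀ p ∈ P, s p p = 0 → p = 0) (hdefQ : ∀ q ∈ Q, s q q = 0 → q = 0)
    (hadj : ∀ X ∈ 𝔊, ∃ Y ∈ 𝔊, ∀ x y, s (X x) y = s x (Y y))
    {B : Module.End ℂ W} (hΘB : Θ * B = B) (hBΘ : B * Θ = -B) (hB0 : B ≠ 0)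
    (hmin : ∀ Z ∈ 𝔊, Θ * Z = Z → Z * Θ = -Z → Z ≠ 0 →
      Module.finrank ℂ (LinearMap.range B) ≤ Module.finrank ℂ (LinearMap.range Z))
    {C : Module.End ℂ W} (hC : C ∈ 𝔊) (hBC : ∀ x y, s (B x) y = s x (C y))
    {ι : Module.End ℂ W} {Um Up QU : Submodule ℂ W} (hιι : ι * ι = 1) (hιΘ : ι * Θ = Θ * ι)
    (hιs : ∀ x y, s (ι x) y = s x (ι y)) (hUm : ∀ x, x ∈ Um ↔ ι x = -x) (hUp : ∀ x, x ∈ Up ↔ ι x = x)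
    (hPM : ∀ x, x ∈ LinearMap.range B ↔ ι x = -x ∧ Θ x = x)
    (hQM : ∀ x, x ∈ Q ⊓ LinearMap.ker B ↔ ι x = -x ∧ Θ x = -x) (hQU : ∀ x, x ∈ QU ↔ ι x = x ∧ Θ x = -x)
    (hfinQU : Module.finrank ℂ QU = Module.finrank ℂ (LinearMap.range B))
    {X Xa Y Ya : Module.End ℂ W} (hX : X ∈ 𝔊) (hΘX : Θ * X = X) (hXΘ : X * Θ = -X) (hXc : X * ι = ι * X)
    (hX0 : X ≠ 0) (hXa : Xa ∈ 𝔊) (hXXa : ∀ x y, s (X x) y = s x (Xa y))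
    (hY : Y ∈ 𝔊) (hΘY : Θ * Y = Y) (hYΘ : Y * Θ = -Y) (hYc : Y * ι = ι * Y) (hYa : Ya ∈ 𝔊)
    (hYYa : ∀ x y, s (Y x) y = s x (Ya y))
    (hsumX : Module.finrank ℂ (Up.map X) + Module.finrank ℂ (Um.map X) = Module.finrank ℂ (LinearMap.range B))
    (hiX : Module.finrank ℂ (Up.map X) ≠ 0)
    (hsumY : Module.finrank ℂ (Up.map Y) + Module.finrank ℂ (Um.map Y) = Module.finrank ℂ (LinearMap.range B))
    (hiY : Module.finrank ℂ (Up.map Y) ≠ 0)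
    (horth : Y * Xa * B + B * Xa * Y = 0) : X * Ya * B + B * Ya * X = 0 := by
  classical
  -- `Y X† Y = 0`
  obtain ⟨ν, hνB⟩ := UnitaryLeviSetup.slot_identity hbr hΘΘ hP hQ hadd hsymm hPQ hdefP hdefQ hadj hΘB hBΘ hB0 hmin hC
    hBC hιι hιΘ hιs hPM hQM hQU hfinQU hY hΘY hYΘ hYc hYYa hΘY hYΘ hYc hYa hYYa
  have horth' : Y * Xa * B + B * Xa * Y = (0 : ℂ) • B := by rw [horth, zero_smul]
  have hν0 := UnitaryLeviSetup.slot_mu_ne_zero hΘΘ hP hQ hadd hsmul hsymm hPQ hdefP hdefQ hιΘ hιs hUp hPM hQM hQU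
    hΘY hYΘ hYc hYYa hνB hiY
  obtain ⟨-, hm0, hp0⟩ := UnitaryLeviSetup.scalar_on_range' hΘΘ hP hQ hadd hsymm hPQ hdefP hdefQ hιι hιΘ hιs hUm hUp hPM
    hQM hQU hfinQU hΘY hYΘ hYc hYYa hΘX hXΘ hXc hXXa hνB horth' hsumY hν0
  have hYXY : Y * Xa * Y = 0 := by
    rw [UnitaryLeviSetup.op_scalar hιι hUm hUp hm0 hp0, zero_smul]
  -- `X Y† X = c' X`
  obtain ⟨μ, hμB⟩ := UnitaryLeviSetup.slot_identity hbr hΘΘ hP hQ hadd hsymm hPQ hdefP hdefQ hadj hΘB hBΘ hB0 hmin hC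
    hBC hιι hιΘ hιs hPM hQM hQU hfinQU hX hΘX hXΘ hXc hXXa hΘX hXΘ hXc hXa hXXa
  obtain ⟨c', hc'B⟩ := UnitaryLeviSetup.slot_identity hbr hΘΘ hP hQ hadd hsymm hPQ hdefP hdefQ hadj hΘB hBΘ hB0 hmin hC
    hBC hιι hιΘ hιs hPM hQM hQU hfinQU hY hΘY hYΘ hYc hYYa hΘX hXΘ hXc hXa hXXa
  have hμ0 := UnitaryLeviSetup.slot_mu_ne_zero hΘΘ hP hQ hadd hsmul hsymm hPQ hdefP hdefQ hιΘ hιs hUp hPM hQM hQU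
    hΘX hXΘ hXc hXXa hμB hiX
  obtain ⟨-, hm1, hp1⟩ := UnitaryLeviSetup.scalar_on_range' hΘΘ hP hQ hadd hsymm hPQ hdefP hdefQ hιι hιΘ hιs hUm hUp hPM
    hQM hQU hfinQU hΘX hXΘ hXc hXXa hΘY hYΘ hYc hYYa hμB hc'B hsumX hμ0
  have hXYX : X * Ya * X = c' • X := UnitaryLeviSetup.op_scalar hιι hUm hUp hm1 hp1
  have hc' : c' = 0 :=
    UnitaryProfileFourSix.slot_symm_zero hΘΘ hP hQ hadd hsymm hPQ hdefP hdefQ hXXa hYYa hYXY hXYX hX0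
  rw [hc'B, hc', zero_smul]

/-! ### §5 TOOL G for `i > 0` -/

/-- `⨅` over `Fin (t+1)` of a family extended by `Fin.snoc`, composed with any map into a complete lattice.
[folklore] -/
private theorem UnitaryOrthogonalChainPos.iInf_comp_snoc {α β : Type*} [CompleteLattice β] {t : ℕ} (f : α → β) (X : Fin t → α)
    (y : α) : (⨅ a, f ((Fin.snoc X y : Fin (t + 1) → α) a)) = (⨅ a, f (X a)) ⊓ f y := by
  apply le_antisymm
  · refine le_inf (le_iInf fun a => ?_) ?_
    · simpa using iInf_le (fun a => f ((Fin.snoc X y : Fin (t + 1) → α) a)) a.castSucc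
    · simpa using iInf_le (fun a => f ((Fin.snoc X y : Fin (t + 1) → α) a)) (Fin.last t)
  · refine le_iInf fun a => ?_
    refine Fin.lastCases ?_ (fun a => ?_) a
    · simp
    · simpa using inf_le_left.trans (iInf_le (fun a => f (X a)) a)

/-- **TOOL G — the orthogonal-chain count for constant profiles `(i, j)` with `i > 0`** (verbatim
`UnitaryOrthogonalChain.false_of_constProfile` with the hypothesis `i < j` replaced by `0 < i`; in particular the
profiles with `i ≥ j` are now covered). See the module docstring. [cite: Ribet1983, Thm. 3] [cite: Gordon1997, Thm. 6.3 (3)]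
[cite: GoodmanWallachGTM255, §2.3.1, §4.1.1] [cite: HoffmanKunze1971LinearAlgebra, §8.5, §3.1 Thm. 2]
[cite: Deligne1982HodgeCycles, I §3 Prop. 3.4, 3.6] -/
theorem UnitaryOrthogonalChain.false_of_constProfile_pos [FiniteDimensional ℂ W] {𝔊 : Submodule ℂ (Module.End ℂ W)}
    (hbr : ∀ Y ∈ 𝔊, ∀ Z ∈ 𝔊, Y * Z - Z * Y ∈ 𝔊) {Θ : Module.End ℂ W} (hΘΘ : Θ * Θ = 1)
    {P Q : Submodule ℂ W} (hP : ∀ x, x ∈ P ↔ Θ x = x) (hQ : ∀ x, x ∈ Q ↔ Θ x = -x)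
    {s : W → W → ℂ} (hadd : ∀ x y z, s (x + y) z = s x z + s y z)
    (hsmul : ∀ (c : ℂ) (x y : W), s (c • x) y = c * s x y) (hsymm : ∀ x y, s y x = starRingEnd ℂ (s x y))
    (hPQ : ∀ p ∈ P, ∀ q ∈ Q, s p q = 0) (hdefP : ∀ p ∈ P, s p p = 0 → p = 0) (hdefQ : ∀ q ∈ Q, s q q = 0 → q = 0)
    (hadj : ∀ X ∈ 𝔊, ∃ Y ∈ 𝔊, ∀ x y, s (X x) y = s x (Y y))
    {B : Module.End ℂ W} (hB : B ∈ 𝔊) (hΘB : Θ * B = B) (hBΘ : B * Θ = -B)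
    (hmin : ∀ Z ∈ 𝔊, Θ * Z = Z → Z * Θ = -Z → Z ≠ 0 →
      Module.finrank ℂ (LinearMap.range B) ≤ Module.finrank ℂ (LinearMap.range Z))
    {ι : Module.End ℂ W} {Um Up PU QU : Submodule ℂ W} (hιι : ι * ι = 1) (hιΘ : ι * Θ = Θ * ι)
    (hιs : ∀ x y, s (ι x) y = s x (ι y)) (hUm : ∀ x, x ∈ Um ↔ ι x = -x) (hUp : ∀ x, x ∈ Up ↔ ι x = x)
    (hPM : ∀ x, x ∈ LinearMap.range B ↔ ι x = -x ∧ Θ x = x)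
    (hQM : ∀ x, x ∈ Q ⊓ LinearMap.ker B ↔ ι x = -x ∧ Θ x = -x)
    (hPU : ∀ x, x ∈ PU ↔ ι x = x ∧ Θ x = x) (hQU : ∀ x, x ∈ QU ↔ ι x = x ∧ Θ x = -x)
    (hfinQU' : Module.finrank ℂ QU = Module.finrank ℂ (LinearMap.range B))
    {i j c : ℕ} (hprof : ∀ X ∈ 𝔊, Θ * X = X → X * Θ = -X → X * ι = ι * X → X ≠ 0 →
      Module.finrank ℂ (Up.map X) = i ∧ Module.finrank ℂ (Um.map X) = j)
    (hipos : 0 < i) (hsumij : i + j = Module.finrank ℂ (LinearMap.range B)) (hic : i + c = Module.finrank ℂ PU)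
    (g G : ℕ → ℕ) (hg0 : Module.finrank ℂ QU ≤ g 0) (hG0 : G 0 = 0)
    (hg : ∀ t, g t ≤ g (t + 1) + (Module.finrank ℂ PU - (t + 1) * c)) (hG : ∀ t, G t + g (t + 1) ≤ G (t + 1))
    (hGlt : ∀ t, G t < Module.finrank ℂ ↥(Q ⊓ LinearMap.ker B))
    (hjoint : ∀ q ∈ Q ⊓ LinearMap.ker B,
      (∀ X ∈ 𝔊, Θ * X = X → X * Θ = -X → X * ι = ι * X → X q = 0) → q = 0) : False := by
  classical
  obtain ⟨haddr, h0r, h0l, hnegr, hnegl, hsubr, hsubl⟩ := UnitaryTwoOdd.herm_right hadd hsymm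
  obtain ⟨C, hC, hBC⟩ := hadj B hB
  have hB0 : B ≠ 0 := fun h => by rw [h, LinearMap.range_zero, finrank_bot] at hsumij; omega
  have hιιv : ∀ v, ι (ι v) = v := fun v => by rw [← Module.End.mul_apply, hιι, Module.End.one_apply]
  have hsum : ∀ X ∈ 𝔊, Θ * X = X → X * Θ = -X → X * ι = ι * X → X ≠ 0 →
      Module.finrank ℂ (Up.map X) + Module.finrank ℂ (Um.map X) = Module.finrank ℂ (LinearMap.range B) := by
    intro X hX hΘX hXΘ hXc hX0
    obtain ⟨h4, h6⟩ := hprof X hX hΘX hXΘ hXc hX0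
    rw [h4, h6, hsumij]
  have hij : ∀ X ∈ 𝔊, Θ * X = X → X * Θ = -X → X * ι = ι * X → X ≠ 0 →
      Module.finrank ℂ (Up.map X) ≠ 0 := by
    intro X hX hΘX hXΘ hXc hX0
    obtain ⟨h4, -⟩ := hprof X hX hΘX hXΘ hXc hX0
    rw [h4]; omega
  -- the subspace `𝔷` of raising elements of `𝔊` commuting with `ι`
  set Zs : Submodule ℂ (Module.End ℂ W) :=
    { carrier := {X | X ∈ 𝔊 ∧ Θ * X = X ∧ X * Θ = -X ∧ X * ι = ι * X}
      zero_mem' := ⟨Submodule.zero_mem _, by rw [mul_zero], by rw [zero_mul, neg_zero], by rw [zero_mul, mul_zero]⟩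
      add_mem' := fun {X Y} hX hY => ⟨Submodule.add_mem _ hX.1 hY.1, by rw [mul_add, hX.2.1, hY.2.1],
        by rw [add_mul, hX.2.2.1, hY.2.2.1, neg_add], by rw [add_mul, mul_add, hX.2.2.2, hY.2.2.2]⟩
      smul_mem' := fun c {X} hX => ⟨Submodule.smul_mem _ c hX.1, by rw [mul_smul_comm, hX.2.1],
        by rw [smul_mul_assoc, hX.2.2.1, smul_neg], by rw [smul_mul_assoc, mul_smul_comm, hX.2.2.2]⟩ }
    with hZsdef
  have hmemZs : ∀ X, X ∈ Zs ↔ X ∈ 𝔊 ∧ Θ * X = X ∧ X * Θ = -X ∧ X * ι = ι * X := fun X => Iff.rfl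
  -- the slot maps `Y ↦ Y X† B + B X† Y`
  let slot : Module.End ℂ W → (Module.End ℂ W →ₗ[ℂ] Module.End ℂ W) := fun Xa =>
    LinearMap.mulRight ℂ (Xa * B) + LinearMap.mulLeft ℂ (B * Xa)
  have hslot : ∀ Xa Y : Module.End ℂ W, slot Xa Y = Y * Xa * B + B * Xa * Y := fun Xa Y => by
    simp only [slot, LinearMap.add_apply, LinearMap.mulRight_apply, LinearMap.mulLeft_apply, mul_assoc]
  -- wrappers of the packages
  have hmem : ∀ X Xa : Module.End ℂ W, X ∈ Zs → X ≠ 0 → Xa ∈ 𝔊 → (∀ x y, s (X x) y = s x (Xa y)) →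
      ∃ μ : ℂ, μ ≠ 0 ∧ starRingEnd ℂ μ = μ ∧ X * Xa * B + B * Xa * X = μ • B ∧ X * Xa * X = μ • X ∧
        (∀ p ∈ Up.map X, X (Xa p) = μ • p) ∧ (∀ p ∈ Um.map X, X (Xa p) = μ • p) ∧
        (∀ p ∈ Um.map X, ∃ q ∈ QU, X q = 0 ∧ B q = p) := by
    intro X Xa hXZ hX0 hXa hXXa
    obtain ⟨hX, hΘX, hXΘ, hXc⟩ := (hmemZs X).1 hXZ
    exact UnitaryProfilePos.member hbr hΘΘ hP hQ hadd hsmul hsymm hPQ hdefP hdefQ hadj hΘB hBΘ hB0 hmin hC hBC hιι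
      hιΘ hιs hUm hUp hPM hQM hQU hfinQU' hX hΘX hXΘ hXc hX0 hXa hXXa (hsum X hX hΘX hXΘ hXc hX0)
      (hij X hX hΘX hXΘ hXc hX0)
  have hpair : ∀ X Xa Y Ya : Module.End ℂ W, ∀ μ : ℂ, X ∈ Zs → X ≠ 0 → Xa ∈ 𝔊 →
      (∀ x y, s (X x) y = s x (Xa y)) → Y ∈ Zs → Y ≠ 0 → Ya ∈ 𝔊 → (∀ x y, s (Y x) y = s x (Ya y)) →
      starRingEnd ℂ μ = μ → X * Xa * B + B * Xa * X = μ • B → X * Xa * X = μ • X →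
      Y * Xa * B + B * Xa * Y = 0 →
      X * Xa * Y + Y * Xa * X = μ • Y ∧ Ya * X * Xa + Xa * X * Ya = μ • Ya := by
    intro X Xa Y Ya μ hXZ hX0 hXa hXXa hYZ hY0 hYa hYYa hμreal hμB hXXX horth
    obtain ⟨hX, hΘX, hXΘ, hXc⟩ := (hmemZs X).1 hXZ
    obtain ⟨hY, hΘY, hYΘ, hYc⟩ := (hmemZs Y).1 hYZ
    obtain ⟨hS, hΘS, hSΘ, hSc⟩ := (hmemZs (X + Y)).1 (Zs.add_mem hXZ hYZ)
    have hS0 : X + Y ≠ 0 := by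
      intro h0
      have hYX : Y = -X := eq_neg_of_add_eq_zero_right h0
      have h1 : Y * Xa * B + B * Xa * Y = -(μ • B) := by rw [hYX, neg_mul, neg_mul, mul_neg, ← neg_add, hμB]
      rw [horth, eq_comm, neg_eq_zero, smul_eq_zero] at h1
      rcases h1 with h1 | h1
      · -- `μ = 0` contradicts `X X† X = μ X`, `X ≠ 0`? use the member package instead: `μ ≠ 0`
        obtain ⟨μ', hμ'0, -, hμ'B, -, -, -, -⟩ := hmem X Xa hXZ hX0 hXa hXXa
        rw [h1, zero_smul] at hμB
        rw [hμB, eq_comm, smul_eq_zero] at hμ'B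
        rcases hμ'B with h | h
        · exact hμ'0 h
        · exact hB0 h
      · exact hB0 h1
    exact UnitaryProfilePos.pair hbr hΘΘ hP hQ hadd hsmul hsymm hPQ hdefP hdefQ hadj hΘB hBΘ hB0 hmin hC hBC hιι
      hιΘ hιs hUm hUp hPM hQM hQU hfinQU' hX hΘX hXΘ hXc hXXa hY hΘY hYΘ hYc hYa hYYa (hsum Y hY hΘY hYΘ hYc hY0)
      (hij Y hY hΘY hYΘ hYc hY0) (hsum _ hS hΘS hSΘ hSc hS0) (hij _ hS hΘS hSΘ hSc hS0) hXa hμreal hμB hXXX horth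
  have hosymm : ∀ X Xa Y Ya : Module.End ℂ W, X ∈ Zs → X ≠ 0 → Xa ∈ 𝔊 → (∀ x y, s (X x) y = s x (Xa y)) →
      Y ∈ Zs → Y ≠ 0 → Ya ∈ 𝔊 → (∀ x y, s (Y x) y = s x (Ya y)) →
      Y * Xa * B + B * Xa * Y = 0 → X * Ya * B + B * Ya * X = 0 := by
    intro X Xa Y Ya hXZ hX0 hXa hXXa hYZ hY0 hYa hYYa horth
    obtain ⟨hX, hΘX, hXΘ, hXc⟩ := (hmemZs X).1 hXZ
    obtain ⟨hY, hΘY, hYΘ, hYc⟩ := (hmemZs Y).1 hYZ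
    exact UnitaryProfilePos.orth_symm hbr hΘΘ hP hQ hadd hsmul hsymm hPQ hdefP hdefQ hadj hΘB hBΘ hB0 hmin hC hBC hιι
      hιΘ hιs hUm hUp hPM hQM hQU hfinQU' hX hΘX hXΘ hXc hX0 hXa hXXa hY hΘY hYΘ hYc hYa hYYa
      (hsum X hX hΘX hXΘ hXc hX0) (hij X hX hΘX hXΘ hXc hX0) (hsum Y hY hΘY hYΘ hYc hY0)
      (hij Y hY hΘY hYΘ hYc hY0) horth
  -- basic geometry of the pieces
  have hBinj : ∀ a ∈ QU, B a = 0 → a = 0 := by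
    intro a ha hBa
    obtain ⟨hιa, hΘa⟩ := (hQU a).1 ha
    have hmem' : a ∈ Q ⊓ LinearMap.ker B := Submodule.mem_inf.2 ⟨(hQ a).2 hΘa, LinearMap.mem_ker.2 hBa⟩
    obtain ⟨hιa', -⟩ := (hQM a).1 hmem'
    rw [hιa] at hιa'
    have h2 : (2 : ℂ) • a = 0 := by rw [two_smul]; nth_rewrite 2 [hιa']; rw [add_neg_cancel]
    exact (smul_eq_zero.1 h2).resolve_left two_ne_zero
  have hmapUpPU : ∀ Y : Module.End ℂ W, Θ * Y = Y → Y * ι = ι * Y → Up.map Y ≤ PU := by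
    intro Y hΘY hYc
    rintro _ ⟨u, hu, rfl⟩
    exact (hPU _).2 ⟨by rw [← Module.End.mul_apply, ← hYc, Module.End.mul_apply, (hUp u).1 hu],
      by rw [← Module.End.mul_apply, hΘY]⟩
  -- THE INDUCTION over orthogonal families, on the dimension of the orthogonal complement in `𝔷`
  suffices key : ∀ (d t : ℕ) (X Xa : Fin t → Module.End ℂ W),
      (∀ a, X a ∈ Zs ∧ X a ≠ 0 ∧ Xa a ∈ 𝔊 ∧ ∀ x y, s (X a x) y = s x (Xa a y)) →
      (∀ a b, a ≠ b → X b * Xa a * B + B * Xa a * X b = 0) →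
      Module.finrank ℂ PU ≤ Module.finrank ℂ ↥(PU ⊓ ⨅ a, Up.map (X a)) + t * c →
      (Module.finrank ℂ ↥(QU ⊓ ⨅ a, LinearMap.ker (X a)) ≤ g t ∧
        Module.finrank ℂ ↥(Q ⊓ LinearMap.ker B) ≤
          Module.finrank ℂ ↥((Q ⊓ LinearMap.ker B) ⊓ ⨅ a, LinearMap.ker (X a)) + G t) →
      Module.finrank ℂ ↥(Zs ⊓ ⨅ a, LinearMap.ker (slot (Xa a))) = d → False by
    refine key _ 0 Fin.elim0 Fin.elim0 (fun a => a.elim0) (fun a => a.elim0) ?_ ?_ rfl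
    · rw [iInf_of_empty, inf_top_eq]; omega
    · rw [iInf_of_empty, inf_top_eq, inf_top_eq, hG0]
      omega
  intro d
  refine Nat.strong_induction_on d ?_
  intro d ih t X Xa hfam horth hH hinv hd
  set N : Submodule ℂ W := QU ⊓ ⨅ a, LinearMap.ker (X a) with hN
  set K : Submodule ℂ W := (Q ⊓ LinearMap.ker B) ⊓ ⨅ a, LinearMap.ker (X a) with hK
  set Hc : Submodule ℂ W := PU ⊓ ⨅ a, Up.map (X a) with hHc
  set Zo : Submodule ℂ (Module.End ℂ W) := Zs ⊓ ⨅ a, LinearMap.ker (slot (Xa a)) with hZo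
  have hm2 : 1 ≤ Module.finrank ℂ K := by
    have h := hGlt t
    omega
  -- member constants of the family
  have hμex : ∀ a, ∃ μ : ℂ, μ ≠ 0 ∧ starRingEnd ℂ μ = μ ∧ X a * Xa a * B + B * Xa a * X a = μ • B ∧
      X a * Xa a * X a = μ • X a ∧ (∀ p ∈ Up.map (X a), X a (Xa a p) = μ • p) ∧
      (∀ p ∈ Um.map (X a), X a (Xa a p) = μ • p) ∧ (∀ p ∈ Um.map (X a), ∃ q ∈ QU, X a q = 0 ∧ B q = p) :=
    fun a => hmem (X a) (Xa a) (hfam a).1 (hfam a).2.1 (hfam a).2.2.1 (hfam a).2.2.2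
  choose μ hμ0 hμreal hμB hXXX hpX hmX hBX using hμex
  by_cases hterm : ∀ Y ∈ Zo, Y = 0
  · -- TERMINAL CASE: `𝔷 = span (X a)`, so `𝔷` kills `K`, so `K = 0` — against `dim K ≥ 2`
    have hKbot : K = ⊥ := by
      refine (Submodule.eq_bot_iff _).2 fun k hk => ?_
      obtain ⟨hkQ, hkX⟩ := Submodule.mem_inf.1 hk
      refine hjoint k hkQ fun Y hY hΘY hYΘ hYc => ?_
      have hYZ : Y ∈ Zs := ⟨hY, hΘY, hYΘ, hYc⟩
      obtain ⟨Ya, hYa, hYYa⟩ := hadj Y hY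
      have hcex : ∀ a, ∃ c : ℂ, Y * Xa a * B + B * Xa a * Y = c • B := by
        intro a
        obtain ⟨hXa1, hΘXa, hXaΘ, hXac⟩ := (hmemZs (X a)).1 (hfam a).1
        exact UnitaryLeviSetup.slot_identity hbr hΘΘ hP hQ hadd hsymm hPQ hdefP hdefQ hadj hΘB hBΘ hB0 hmin hC hBC hιι
          hιΘ hιs hPM hQM hQU hfinQU' hXa1 hΘXa hXaΘ hXac (hfam a).2.2.2 hΘY hYΘ hYc hYa hYYa
      choose c hc using hcex
      set Y' : Module.End ℂ W := Y - ∑ a, (c a / μ a) • X a with hY'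
      have hY'Z : Y' ∈ Zs :=
        Zs.sub_mem hYZ (Zs.sum_mem fun a _ => Zs.smul_mem _ (hfam a).1)
      have hY'orth : ∀ b, slot (Xa b) Y' = 0 := by
        intro b
        rw [hY', map_sub, map_sum, hslot, hc b, Finset.sum_eq_single b, map_smul, hslot, hμB b, smul_smul,
          div_mul_cancel₀ _ (hμ0 b), sub_self]
        · intro a _ hab
          rw [map_smul, hslot, horth b a (Ne.symm hab), smul_zero]
        · intro h; exact absurd (Finset.mem_univ b) h
      have hY'0 : Y' = 0 := hterm Y' (Submodule.mem_inf.2 ⟨hY'Z, (Submodule.mem_iInf _).2 fun b =>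
        LinearMap.mem_ker.2 (hY'orth b)⟩)
      have hYsum : Y = ∑ a, (c a / μ a) • X a := sub_eq_zero.1 (by rw [← hY']; exact hY'0)
      rw [hYsum, LinearMap.sum_apply]
      refine Finset.sum_eq_zero fun a _ => ?_
      rw [LinearMap.smul_apply, LinearMap.mem_ker.1 ((Submodule.mem_iInf _).1 hkX a), smul_zero]
    rw [hKbot, finrank_bot] at hm2
    omega
  · -- INDUCTIVE CASE: extend the family by a non-zero `Y ∈ 𝔷` orthogonal to it
    push Not at hterm
    obtain ⟨Y, hYZo, hY0⟩ := hterm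
    obtain ⟨hYZ, hYorth⟩ := Submodule.mem_inf.1 hYZo
    have hYo : ∀ a, Y * Xa a * B + B * Xa a * Y = 0 := fun a => by
      have h := (Submodule.mem_iInf _).1 hYorth a
      rw [LinearMap.mem_ker, hslot] at h
      exact h
    obtain ⟨hY, hΘY, hYΘ, hYc⟩ := (hmemZs Y).1 hYZ
    obtain ⟨Ya, hYa, hYYa⟩ := hadj Y hY
    obtain ⟨hΘYa, hYaΘ, hYac, hYaY⟩ :=
      UnitaryLeviSetup.adj_raise hΘΘ hP hQ hadd hsymm hPQ hdefP hdefQ hιs hΘY hYΘ hYc hYYa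
    obtain ⟨μY, hμY0, hμYreal, hμYB, hYYY, hpY, hmY, hBY⟩ := hmem Y Ya hYZ hY0 hYa hYYa
    have hYij := hprof Y hY hΘY hYΘ hYc hY0
    -- (II) and (II)† for the pairs `(X a, Y)`
    have hII : ∀ a, X a * Xa a * Y + Y * Xa a * X a = μ a • Y ∧ Ya * X a * Xa a + Xa a * X a * Ya = μ a • Ya :=
      fun a => hpair (X a) (Xa a) Y Ya (μ a) (hfam a).1 (hfam a).2.1 (hfam a).2.2.1 (hfam a).2.2.2 hYZ hY0 hYa hYYa
        (hμreal a) (hμB a) (hXXX a) (hYo a)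
    -- the new family
    set X' : Fin (t + 1) → Module.End ℂ W := Fin.snoc X Y with hX'
    set Xa' : Fin (t + 1) → Module.End ℂ W := Fin.snoc Xa Ya with hXa'
    have hfam' : ∀ a, X' a ∈ Zs ∧ X' a ≠ 0 ∧ Xa' a ∈ 𝔊 ∧ ∀ x y, s (X' a x) y = s x (Xa' a y) := by
      intro a
      refine Fin.lastCases ?_ (fun a => ?_) a
      · simp only [hX', hXa', Fin.snoc_last]; exact ⟨hYZ, hY0, hYa, hYYa⟩
      · simp only [hX', hXa', Fin.snoc_castSucc]; exact hfam a
    have horth' : ∀ a b, a ≠ b → X' b * Xa' a * B + B * Xa' a * X' b = 0 := by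
      intro a b hab
      induction a using Fin.lastCases with
      | last =>
        induction b using Fin.lastCases with
        | last => exact absurd rfl hab
        | cast b =>
          simp only [hX', hXa', Fin.snoc_last, Fin.snoc_castSucc]
          exact hosymm (X b) (Xa b) Y Ya (hfam b).1 (hfam b).2.1 (hfam b).2.2.1 (hfam b).2.2.2 hYZ hY0 hYa hYYa (hYo b)
      | cast a =>
        induction b using Fin.lastCases with
        | last => simp only [hX', hXa', Fin.snoc_last, Fin.snoc_castSucc]; exact hYo a
        | cast b =>
          simp only [hX', hXa', Fin.snoc_castSucc]
          exact horth a b fun h => hab (by rw [h])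
    -- the new pieces
    have hN' : (QU ⊓ ⨅ a, LinearMap.ker (X' a)) = N ⊓ LinearMap.ker Y := by
      rw [hX', UnitaryOrthogonalChainPos.iInf_comp_snoc (fun Z : Module.End ℂ W => LinearMap.ker Z), hN, inf_assoc]
    have hK' : ((Q ⊓ LinearMap.ker B) ⊓ ⨅ a, LinearMap.ker (X' a)) = K ⊓ LinearMap.ker Y := by
      rw [hX', UnitaryOrthogonalChainPos.iInf_comp_snoc (fun Z : Module.End ℂ W => LinearMap.ker Z), hK]
      simp only [inf_assoc]
    have hHc' : (PU ⊓ ⨅ a, Up.map (X' a)) = Hc ⊓ Up.map Y := by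
      rw [hX', UnitaryOrthogonalChainPos.iInf_comp_snoc (fun Z : Module.End ℂ W => Up.map Z), hHc, inf_assoc]
    have hZo' : (Zs ⊓ ⨅ a, LinearMap.ker (slot (Xa' a))) = Zo ⊓ LinearMap.ker (slot Ya) := by
      rw [hXa', UnitaryOrthogonalChainPos.iInf_comp_snoc (fun Z : Module.End ℂ W => LinearMap.ker (slot Z)), hZo, inf_assoc]
    -- (R1) rank–nullity for `Y` on `N` and on `K`
    have hR1 := UnitaryProfileFourSix.finrank_inf_ker_add_finrank_map N Y
    have hR1K := UnitaryProfileFourSix.finrank_inf_ker_add_finrank_map K Y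
    -- (R2) `Hc ∩ Y(U⁺) ⊆ Y(N)`
    have hR2 : Hc ⊓ Up.map Y ≤ N.map Y := by
      intro p hp
      obtain ⟨hpHc, hpUY⟩ := Submodule.mem_inf.1 hp
      obtain ⟨hpPU, hpXcap⟩ := Submodule.mem_inf.1 hpHc
      obtain ⟨hιp, -⟩ := (hPU p).1 hpPU
      refine ⟨μY⁻¹ • Ya p, Submodule.mem_inf.2 ⟨Submodule.smul_mem _ _ ((hQU _).2 ⟨?_, ?_⟩),
        (Submodule.mem_iInf _).2 fun a => LinearMap.mem_ker.2 ?_⟩, ?_⟩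
      · rw [← Module.End.mul_apply, ← hYac, Module.End.mul_apply, hιp]
      · rw [← Module.End.mul_apply, hΘYa, LinearMap.neg_apply]
      · -- `X a (Y† p) = 0` from (II)† and `X a X a† p = μ a p`
        rw [map_smul]
        have hpa : p ∈ Up.map (X a) := (Submodule.mem_iInf _).1 hpXcap a
        have h := congrArg (fun T : Module.End ℂ W => T p) (hII a).2
        simp only [LinearMap.add_apply, Module.End.mul_apply, LinearMap.smul_apply] at h
        rw [hpX a p hpa, map_smul, add_eq_left] at h
        obtain ⟨-, hΘXa1, -, -⟩ := (hmemZs (X a)).1 (hfam a).1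
        have hmemP : X a (Ya p) ∈ P := (hP _).2 (by rw [← Module.End.mul_apply, hΘXa1])
        have h0 : X a (Ya p) = 0 := hdefP _ hmemP (by rw [(hfam a).2.2.2, h, h0r])
        rw [h0, smul_zero]
      · rw [map_smul, hpY p hpUY, smul_smul, inv_mul_cancel₀ hμY0, one_smul]
    -- (R3) `dim (Hc ∩ Y(U⁺)) + 1 ≥ dim Hc` (`Y(U⁺)` is a hyperplane of `P ∩ U⁺`)
    have hR3 : Module.finrank ℂ Hc ≤ Module.finrank ℂ ↥(Hc ⊓ Up.map Y) + c := by
      have h1 := Submodule.finrank_sup_add_finrank_inf_eq Hc (Up.map Y)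
      have h2 : Module.finrank ℂ ↥(Hc ⊔ Up.map Y) ≤ Module.finrank ℂ PU :=
        Submodule.finrank_mono (sup_le inf_le_left (hmapUpPU Y hΘY hYc))
      rw [hYij.1] at h1
      omega
    -- (R4) `Y(K) ⊆ B(N ∩ ker Y)`
    have hR4 : Module.finrank ℂ (K.map Y) ≤ Module.finrank ℂ ↥(N ⊓ LinearMap.ker Y) := by
      have hle : K.map Y ≤ (N ⊓ LinearMap.ker Y).map B := by
        rintro _ ⟨k, hk, rfl⟩
        obtain ⟨hkQ, hkX⟩ := Submodule.mem_inf.1 hk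
        obtain ⟨hιk, -⟩ := (hQM k).1 hkQ
        have hkUm : k ∈ Um := (hUm k).2 hιk
        obtain ⟨q, hqQU, hYq, hBq⟩ := hBY (Y k) (Submodule.mem_map_of_mem hkUm)
        refine ⟨q, Submodule.mem_inf.2 ⟨Submodule.mem_inf.2 ⟨hqQU, (Submodule.mem_iInf _).2 fun a =>
          LinearMap.mem_ker.2 ?_⟩, LinearMap.mem_ker.2 hYq⟩, hBq⟩
        -- `Y k ∈ X a(U⁻)` by (II), so `Y k = B q_a` with `X a q_a = 0`, and `q_a = q`
        have hXak : X a k = 0 := LinearMap.mem_ker.1 ((Submodule.mem_iInf _).1 hkX a)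
        have h := congrArg (fun T : Module.End ℂ W => T k) (hII a).1
        simp only [LinearMap.add_apply, Module.End.mul_apply, LinearMap.smul_apply, hXak, map_zero, add_zero] at h
        have hYkUm : Y k ∈ Um :=
          (hUm _).2 (by rw [← Module.End.mul_apply, ← hYc, Module.End.mul_apply, hιk, map_neg])
        obtain ⟨hXa1, hΘXa1, hXaΘ1, hXac1⟩ := (hmemZs (X a)).1 (hfam a).1
        obtain ⟨-, -, hXaac, -⟩ :=
          UnitaryLeviSetup.adj_raise hΘΘ hP hQ hadd hsymm hPQ hdefP hdefQ hιs hΘXa1 hXaΘ1 hXac1 (hfam a).2.2.2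
        have hmemUm : Xa a (Y k) ∈ Um :=
          (hUm _).2 (by rw [← Module.End.mul_apply, ← hXaac, Module.End.mul_apply, (hUm _).1 hYkUm, map_neg])
        have hYk : Y k ∈ Um.map (X a) := by
          have e : Y k = (μ a)⁻¹ • X a (Xa a (Y k)) := by rw [h, smul_smul, inv_mul_cancel₀ (hμ0 a), one_smul]
          rw [e]; exact Submodule.smul_mem _ _ (Submodule.mem_map_of_mem hmemUm)
        obtain ⟨qa, hqaQU, hXqa, hBqa⟩ := hBX a (Y k) hYk
        have hqq : qa = q := by
          have h0 : B (qa - q) = 0 := by rw [map_sub, hBqa, hBq, sub_self]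
          exact sub_eq_zero.1 (hBinj _ (Submodule.sub_mem _ hqaQU hqQU) h0)
        rw [← hqq]; exact hXqa
      exact (Submodule.finrank_mono hle).trans (Submodule.finrank_map_le _ _)
    -- (R5) the orthogonal complement shrinks strictly
    have hlt : Module.finrank ℂ ↥(Zo ⊓ LinearMap.ker (slot Ya)) < d := by
      rw [← hd]
      refine Submodule.finrank_lt_finrank_of_lt (lt_of_le_of_ne inf_le_left fun heq => ?_)
      have hYmem : Y ∈ Zo ⊓ LinearMap.ker (slot Ya) := by rw [heq]; exact hYZo
      have h := (Submodule.mem_inf.1 hYmem).2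
      rw [LinearMap.mem_ker, hslot, hμYB] at h
      rcases smul_eq_zero.1 h with h | h
      · exact hμY0 h
      · exact hB0 h
    -- apply the induction hypothesis to the extended family
    have h2' := Submodule.finrank_mono hR2
    have hd' : Module.finrank ℂ ↥(Zs ⊓ ⨅ a, LinearMap.ker (slot (Xa' a))) =
        Module.finrank ℂ ↥(Zo ⊓ LinearMap.ker (slot Ya)) := by
      rw [hZo']
    have hmulc : (t + 1) * c = t * c + c := by ring
    have hgt := hg t
    have hGt := hG t
    refine ih _ hlt (t + 1) X' Xa' hfam' horth' ?_ ?_ hd'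
    · rw [hHc']; omega
    · rw [hN', hK']
      rw [hHc'] at *
      constructor
      · omega
      · omega

end HodgeStructure

end Literature.AlgebraicGeometry.Motives

end
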